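import Mathlib
import HarnessLib.Audit
import HarnessLib

/-!
# L3TimeExponentPincer — ring datum calculus IV: the glued dipole profile

Support kernel for the crux `L3CascadeJaw` (item stmt-NavierStokesRegularity-19499): the
one-variable real analysis of the explicit ring datum for `lpPersistence_of_ringData`
(`L3TimeExponentPincerRingPersistence`).  The datum is `u₀ = curl (F(|x|²) J)` with
`ω_θ/r = −(4sF'' + 10F')(|x|²)` (`angVortQuot_ringField`); the profile is designed through its
DERIVATIVE `F' = F₁`, `F₁(s) = s^{-5/2} G(s)`, because of the key identity
`4s F₁' + 10 F₁ = 4 s^{-3/2} G'` (`four_mul_deriv_rpowProfile_add`): the sign of `ω_θ/r` is the sign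
of `−G'`, and `G ≡ const` gives the exact irrotational-`η` dipole zone.  Here, for an abstract
`G ∈ C^∞` vanishing on `(−∞, a]` (`a > 0`):

* `contDiff_rpowProfile` — `F₁ ∈ C^∞(ℝ)`;
* `four_mul_deriv_rpowProfile_add` — the key identity for `s > 0`, and `rpowProfile_eq_zero`,
  `deriv_rpowProfile_eq_zero` below `a`;
* `contDiff_primitive`, `deriv_primitive`, `primitive_eq_zero_of_ge` — the primitive
  `F(s) = ∫_R^s F₁` is smooth with `F' = F₁` and vanishes on `[R, ∞)` when `G` does;
* `integral_rpow_neg_five_halves` — `∫_s^b τ^{-5/2} dτ = (2/3)(s^{-3/2} − b^{-3/2})`;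
* `abs_primitive_le`, `primitive_nonneg`, `primitive_ge_of_plateau` — size, sign and the
  dipole-zone lower bound of `F` when `−K ≤ G ≤ 0` (`G = −K` on the plateau).

WHAT THIS IS NOT: pure one-variable calculus; no fluid statement.
-/

namespace Summit.NavierStokesRegularity.NavierStokesRegularity.Theorems.L3TimeExponentPincerRingDatumProfile

open Real Set MeasureTheory intervalIntegral
open scoped ContDiff Topology

variable {G : ℝ → ℝ} {a R K : ℝ}

/-! ### A. The derivative profile `F₁(s) = s^{-5/2} G(s)` -/

/-- **Smoothness of `s ↦ s^p G(s)`** for `G ∈ C^∞` vanishing on `(−∞, a]`, `a > 0` (the `rpow` is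
smooth away from `0`, and the product vanishes identically near every `s < a`). -/
theorem contDiff_rpow_mul (hG : ContDiff ℝ ∞ G) (ha : 0 < a) (hGa : ∀ s, s ≤ a → G s = 0) (p : ℝ) :
    ContDiff ℝ ∞ (fun s : ℝ => s ^ p * G s) := by
  rw [contDiff_iff_contDiffAt]
  intro s
  rcases lt_or_ge (a / 2) s with hs | hs
  · have hs0 : s ≠ 0 := by intro h0; rw [h0] at hs; linarith
    exact (Real.contDiffAt_rpow_const_of_ne hs0).mul hG.contDiffAt
  · have hev : (fun s : ℝ => s ^ p * G s) =ᶠ[𝓝 s] fun _ => (0 : ℝ) := by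
      have hI : Iio a ∈ 𝓝 s := Iio_mem_nhds (by linarith)
      filter_upwards [hI] with t ht
      rw [hGa t (le_of_lt ht), mul_zero]
    exact contDiffAt_const.congr_of_eventuallyEq hev

/-- `F₁ = s^{-5/2} G ∈ C^∞(ℝ)`. -/
theorem contDiff_rpowProfile (hG : ContDiff ℝ ∞ G) (ha : 0 < a) (hGa : ∀ s, s ≤ a → G s = 0) :
    ContDiff ℝ ∞ (fun s : ℝ => s ^ (-(5 / 2 : ℝ)) * G s) :=
  contDiff_rpow_mul hG ha hGa _

/-- `F₁ = 0` on `(−∞, a]`. -/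
theorem rpowProfile_eq_zero (hGa : ∀ s, s ≤ a → G s = 0) {s : ℝ} (hs : s ≤ a) :
    s ^ (-(5 / 2 : ℝ)) * G s = 0 := by
  rw [hGa s hs, mul_zero]

/-- `F₁' = 0` on `(−∞, a)`. -/
theorem deriv_rpowProfile_eq_zero (hGa : ∀ s, s ≤ a → G s = 0) {s : ℝ} (hs : s < a) :
    deriv (fun s : ℝ => s ^ (-(5 / 2 : ℝ)) * G s) s = 0 := by
  have hev : (fun s : ℝ => s ^ (-(5 / 2 : ℝ)) * G s) =ᶠ[𝓝 s] fun _ => (0 : ℝ) := by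
    filter_upwards [Iio_mem_nhds hs] with t ht
    rw [hGa t (le_of_lt ht), mul_zero]
  rw [hev.deriv_eq, deriv_const]

/-- Derivative of `s ↦ s^p G(s)` at `s > 0`. -/
theorem deriv_rpow_mul (hG : Differentiable ℝ G) {s : ℝ} (hs : 0 < s) (p : ℝ) :
    deriv (fun s : ℝ => s ^ p * G s) s = p * s ^ (p - 1) * G s + s ^ p * deriv G s := by
  have h1 : HasDerivAt (fun s : ℝ => s ^ p) (p * s ^ (p - 1)) s :=
    Real.hasDerivAt_rpow_const (Or.inl hs.ne')
  exact (h1.mul (hG s).hasDerivAt).deriv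

/-- **Key identity**: for `F₁(s) = s^{-5/2} G(s)` and `s > 0`,
`4s F₁'(s) + 10 F₁(s) = 4 s^{-3/2} G'(s)` (i.e. `4sF₁' + 10F₁ = 4s^{-3/2}(s^{5/2}F₁)'`). -/
theorem four_mul_deriv_rpowProfile_add (hG : Differentiable ℝ G) {s : ℝ} (hs : 0 < s) :
    4 * s * deriv (fun s : ℝ => s ^ (-(5 / 2 : ℝ)) * G s) s + 10 * (s ^ (-(5 / 2 : ℝ)) * G s) =
      4 * s ^ (-(3 / 2 : ℝ)) * deriv G s := by
  rw [deriv_rpow_mul hG hs]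
  have e1 : s * s ^ (-(5 / 2 : ℝ) - 1) = s ^ (-(5 / 2 : ℝ)) := by
    rw [Real.rpow_sub_one hs.ne']
    field_simp
  have e2 : s * s ^ (-(5 / 2 : ℝ)) = s ^ (-(3 / 2 : ℝ)) := by
    rw [show (-(3 / 2 : ℝ)) = -(5 / 2 : ℝ) + 1 by norm_num, Real.rpow_add_one hs.ne']
    ring
  linear_combination (4 * (-(5 / 2 : ℝ)) * G s) * e1 + (4 * deriv G s) * e2

/-! ### B. The primitive `F(s) = ∫_R^s F₁` -/

/-- The primitive of a continuous function is differentiable with derivative the integrand. -/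
theorem hasDerivAt_primitive {f : ℝ → ℝ} (hf : Continuous f) (R s : ℝ) :
    HasDerivAt (fun t => ∫ τ in R..t, f τ) (f s) s :=
  (hf.integral_hasStrictDerivAt R s).hasDerivAt

/-- `deriv (∫_R^· f) = f` for continuous `f`. -/
theorem deriv_primitive {f : ℝ → ℝ} (hf : Continuous f) (R : ℝ) :
    deriv (fun t => ∫ τ in R..t, f τ) = f :=
  funext fun s => (hasDerivAt_primitive hf R s).deriv

/-- **The primitive of a smooth function is smooth.** -/
theorem contDiff_primitive {f : ℝ → ℝ} (hf : ContDiff ℝ ∞ f) (R : ℝ) :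
    ContDiff ℝ ∞ (fun t => ∫ τ in R..t, f τ) := by
  rw [contDiff_infty_iff_deriv, deriv_primitive hf.continuous R]
  exact ⟨fun s => (hasDerivAt_primitive hf.continuous R s).differentiableAt, hf⟩

/-- If `f = 0` on `[R, ∞)` then `∫_R^s f = 0` for `s ≥ R`. -/
theorem primitive_eq_zero_of_ge {f : ℝ → ℝ} (hf0 : ∀ τ, R ≤ τ → f τ = 0) {s : ℝ} (hs : R ≤ s) :
    ∫ τ in R..s, f τ = 0 := by
  rw [intervalIntegral.integral_congr (g := fun _ => (0 : ℝ)) (fun τ hτ => ?_),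
    intervalIntegral.integral_zero]
  rw [uIcc_of_le hs] at hτ
  exact hf0 τ hτ.1

/-- If `f = 0` on `(−∞, a]` then `∫_R^s f = ∫_R^a f` for `s ≤ a` (the primitive is constant below `a`). -/
theorem primitive_eq_of_le {f : ℝ → ℝ} (hf : Continuous f) (hf0 : ∀ τ, τ ≤ a → f τ = 0) {s : ℝ}
    (hs : s ≤ a) : ∫ τ in R..s, f τ = ∫ τ in R..a, f τ := by
  have hadd := integral_add_adjacent_intervals (hf.intervalIntegrable (μ := volume) R s)
    (hf.intervalIntegrable (μ := volume) s a)
  have h0 : ∫ τ in s..a, f τ = 0 := by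
    rw [intervalIntegral.integral_congr (g := fun _ => (0 : ℝ)) (fun τ hτ => ?_),
      intervalIntegral.integral_zero]
    rw [uIcc_of_le hs] at hτ
    exact hf0 τ hτ.2
  rw [← hadd, h0, add_zero]

/-! ### C. The model integral and bounds on the primitive -/

/-- `∫_s^b τ^{-5/2} dτ = (2/3)(s^{-3/2} − b^{-3/2})` for `0 < s`, `0 < b`. -/
theorem integral_rpow_neg_five_halves {s b : ℝ} (hs : 0 < s) (hb : 0 < b) :
    ∫ τ in s..b, τ ^ (-(5 / 2 : ℝ)) = (2 / 3) * (s ^ (-(3 / 2 : ℝ)) - b ^ (-(3 / 2 : ℝ))) := by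
  rw [integral_rpow (Or.inr ⟨by norm_num, notMem_uIcc_of_lt hs hb⟩)]
  rw [show (-(5 / 2 : ℝ) + 1) = -(3 / 2 : ℝ) by norm_num]
  field_simp
  ring

/-- `τ^{-5/2}` is continuous on `[s, b]` for `s > 0`, hence interval integrable. -/
theorem intervalIntegrable_rpow_neg_five_halves {s b : ℝ} (hs : 0 < s) (hsb : s ≤ b) :
    IntervalIntegrable (fun τ : ℝ => τ ^ (-(5 / 2 : ℝ))) volume s b := by
  refine ContinuousOn.intervalIntegrable ?_
  rw [uIcc_of_le hsb]
  exact fun τ hτ => (Real.continuousAt_rpow_const τ (-(5 / 2 : ℝ))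
    (Or.inl (by linarith [hτ.1] : τ ≠ 0))).continuousWithinAt

/-- **Size of the primitive above `a`**: if `|G| ≤ K` then for `0 < s ≤ R`,
`|∫_R^s τ^{-5/2}G| ≤ (2K/3)(s^{-3/2} − R^{-3/2}) ≤ (2K/3) s^{-3/2}`. -/
theorem abs_primitive_le (hK : ∀ τ, |G τ| ≤ K) {s : ℝ} (hs : 0 < s) (hsR : s ≤ R) :
    |∫ τ in R..s, τ ^ (-(5 / 2 : ℝ)) * G τ| ≤ (2 * K / 3) * s ^ (-(3 / 2 : ℝ)) := by
  have hR : 0 < R := hs.trans_le hsR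
  have hK0 : 0 ≤ K := (abs_nonneg _).trans (hK 0)
  rw [integral_symm, abs_neg]
  have h1 : |∫ τ in s..R, τ ^ (-(5 / 2 : ℝ)) * G τ| ≤ ∫ τ in s..R, K * τ ^ (-(5 / 2 : ℝ)) := by
    rw [← Real.norm_eq_abs]
    refine intervalIntegral.norm_integral_le_of_norm_le hsR ?_
      ((intervalIntegrable_rpow_neg_five_halves hs hsR).const_mul K)
    filter_upwards with τ hτ
    rw [norm_mul, Real.norm_eq_abs, Real.norm_eq_abs,
      abs_of_nonneg (Real.rpow_nonneg (hs.le.trans hτ.1.le) _), mul_comm]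
    exact mul_le_mul_of_nonneg_right (hK τ) (Real.rpow_nonneg (hs.le.trans hτ.1.le) _)
  refine h1.trans ?_
  rw [intervalIntegral.integral_const_mul, integral_rpow_neg_five_halves hs hR]
  have hRpos : 0 ≤ R ^ (-(3 / 2 : ℝ)) := Real.rpow_nonneg hR.le _
  nlinarith

/-- **Sign of the primitive**: if `G ≤ 0` then `∫_R^s τ^{-5/2}G ≥ 0` for `0 < s ≤ R`
(`F(s) = −∫_s^R F₁` with `F₁ ≤ 0`). -/
theorem primitive_nonneg (hG0 : ∀ τ, G τ ≤ 0) {s : ℝ} (hs : 0 < s) (hsR : s ≤ R) :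
    0 ≤ ∫ τ in R..s, τ ^ (-(5 / 2 : ℝ)) * G τ := by
  rw [integral_symm]
  rw [le_neg, neg_zero]
  have : ∫ τ in s..R, τ ^ (-(5 / 2 : ℝ)) * G τ = -∫ τ in s..R, τ ^ (-(5 / 2 : ℝ)) * (-G τ) := by
    rw [← intervalIntegral.integral_neg]
    congr 1; funext τ; ring
  rw [this, neg_nonpos]
  refine intervalIntegral.integral_nonneg hsR fun τ hτ => ?_
  exact mul_nonneg (Real.rpow_nonneg (hs.le.trans hτ.1) _) (by linarith [hG0 τ])

/-- Interval integrability of `τ^{-5/2} G` on `[s, b]`, `s > 0`. -/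
theorem intervalIntegrable_rpowProfile (hG : Continuous G) {s b : ℝ} (hs : 0 < s) (hsb : s ≤ b) :
    IntervalIntegrable (fun τ : ℝ => τ ^ (-(5 / 2 : ℝ)) * G τ) volume s b := by
  refine ContinuousOn.intervalIntegrable ?_
  rw [uIcc_of_le hsb]
  intro τ hτ
  exact ((Real.continuousAt_rpow_const τ (-(5 / 2 : ℝ))
    (Or.inl (by linarith [hτ.1] : τ ≠ 0))).mul hG.continuousAt).continuousWithinAt

/-- **Dipole-zone lower bound**: if `G ≤ 0` everywhere and `G = −K` on `[s, b]` with
`0 < s ≤ b ≤ R`, then `∫_R^s τ^{-5/2}G ≥ (2K/3)(s^{-3/2} − b^{-3/2})`. -/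
theorem primitive_ge_of_plateau (hG : Continuous G) (hG0 : ∀ τ, G τ ≤ 0)
    {s b : ℝ} (hs : 0 < s) (hsb : s ≤ b) (hbR : b ≤ R) (hplat : ∀ τ ∈ Icc s b, G τ = -K) :
    (2 * K / 3) * (s ^ (-(3 / 2 : ℝ)) - b ^ (-(3 / 2 : ℝ))) ≤
      ∫ τ in R..s, τ ^ (-(5 / 2 : ℝ)) * G τ := by
  have hb : 0 < b := hs.trans_le hsb
  rw [integral_symm, ← integral_add_adjacent_intervals (intervalIntegrable_rpowProfile hG hs hsb)
    (intervalIntegrable_rpowProfile hG hb hbR)]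
  have h1 : ∫ τ in s..b, τ ^ (-(5 / 2 : ℝ)) * G τ = -K * ((2 / 3) * (s ^ (-(3 / 2 : ℝ)) - b ^ (-(3 / 2 : ℝ)))) := by
    rw [← integral_rpow_neg_five_halves hs hb, ← intervalIntegral.integral_const_mul]
    refine intervalIntegral.integral_congr fun τ hτ => ?_
    rw [uIcc_of_le hsb] at hτ
    simp only [hplat τ hτ]
    ring
  have h2 : ∫ τ in b..R, τ ^ (-(5 / 2 : ℝ)) * G τ ≤ 0 := by
    have : ∫ τ in b..R, τ ^ (-(5 / 2 : ℝ)) * G τ = -∫ τ in b..R, τ ^ (-(5 / 2 : ℝ)) * (-G τ) := by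
      rw [← intervalIntegral.integral_neg]
      congr 1; funext τ; ring
    rw [this, neg_nonpos]
    refine intervalIntegral.integral_nonneg hbR fun τ hτ => ?_
    exact mul_nonneg (Real.rpow_nonneg (hb.le.trans hτ.1) _) (by linarith [hG0 τ])
  rw [h1]
  linarith

end Summit.NavierStokesRegularity.NavierStokesRegularity.Theorems.L3TimeExponentPincerRingDatumProfile
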